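import Mathlib
import HarnessLib
import HarnessLib.Audit
import Summits.ValiantsHypothesis.Statement
import Literature.Computability.AlgebraicComplexity.DeterminantalComplexity
import Literature.Computability.AlgebraicComplexity.PermanentVsDeterminant
import Literature.Computability.AlgebraicComplexity.ValiantConjecture
import Literature.Computability.AlgebraicComplexity.VPDeterminantalQPProofs
import Literature.Computability.AlgebraicComplexity.ValiantConjectureProofs

/-!
Route: UlrichPadded

CLOSED (superseded) 2026-08-17T15:43:01Z by planner-rbadge-ValiantsHypothesis-UlrichPadded-e28f341f-g3-0 — reason: superseded:route-ValiantsHypothesis-DetQP — superseded by route-ValiantsHypothesis-DetQP — note: superseded by route-ValiantsHypothesis-DetQP (tribunal FAIL summit-strength, kernel-final). CENSUS — Tried: the padded-linear-factorisation engine was fully worked and PROVED (PermHypersurfaceFactorial, RankOneTrivialisation, CofactorDegreeFloor, PaddedDictionary, NoGlobalSplitting, LevelledCorankTw. The file is kept as the record of this route; refuted decls are indexed as negative knowledge (`ledger negatives`).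

# Route UlrichPadded — padded linear factorizations of per_n over the factorial permanental ring —
dc as a kernel-degree budget

X (shared with route DetQP, decl DetqpThesis): the affine determinantal complexity dc(per_n) over ℂ
is not quasi-polynomially
bounded. This route realises card ulrich-padded-rank-one: homogenise a size-m representation per_n =
det(A₀ + L(x)) to the LINEAR
matrix M = x₀A₀ + L(x) with det M = x₀^(m−n)·per_n (a det-type Ulrich sheaf on the non-reduced
hypersurface (m−n)H + Cone V(per_n));
the coordinate ring S = ℂ[x]/(per_n) is FACTORIAL for n ≥ 3 (Grothendieck–Samuel parafactoriality +
von zur Gathen's codim-5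
singular locus), which trivialises the kernel sheaf of every representation — adj A ≡ c·wᵀ (mod
per_n), deg c + deg w ≤ m − 1 —
and turns dc into a budget m = (2n−1) + exc_c + exc_w + j of three non-negative integers
(kernel-degree excesses and the order j of
vanishing of adj M along x₀ = 0 modulo per_n) attached to the representation IN ITS GIVEN AFFINE
GAUGE — they are NOT invariants of
its polynomial gauge class: the affineness-preserving null-transvection twist (1+V)·Grenet₇·(1+U) of
per_3 moves (exc_c, exc_w, j)
from Grenet's (0, 0, 2) to (1, 1, 0) at the same optimal size m = 7
(Theorems/UlrichPaddedNoTightInfinityRefutation.lean,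
2026-08-15; the former crux NoTightInfinity 'j ≥ 1 always' is REFUTED and dropped). X is attacked by
bounding the budget SUM
exc_c + exc_w + j (= m − 2n + 1, gauge-invariant by construction) through joint inequalities, never
one coordinate at a time.
Lean: `¬ Literature.Computability.AlgebraicComplexity.IsQPBounded (fun n =>
Literature.Computability.AlgebraicComplexity.determinantalComplexity
(Literature.Computability.AlgebraicComplexity.perPoly (Fin n) ℂ))`

## Assembly
Logical assembly runs through the shared target exactly as in DetQP (bookkeeping, proved sorry-free
in Sketch.lean): VP families have
quasi-polynomially bounded dc (in tree: `isQPBounded_determinantalComplexity_of_isVPFamily_holds`),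
so Target ⇒ per ∉ VP, and with
per ∈ VNP ⇒ VP ℂ ≠ VNP ℂ. The cruxes are the padded engine's ladder towards Target
(PermHypersurfaceFactorial → RankOneTrivialisation →
budget identity → Superquadratic as the first quantitative rung; the former rung NoTightInfinity,
stmt-ValiantsHypothesis-5668, is
refuted-substantive and dropped 2026-08-15 — tight-at-infinity representations exist at optimal
size), not extra hypotheses of the
implication: the deciding theorem `closes` uses Target alone.

Rationale: WHY THIS LINE. Every known dc lower bound is local (Hessian rank MignonRessayre2004, dual variety
arXiv:1004.4802, singular locus
AlperBogartVelasco2017) and saturates at Θ(n²) (Landsberg2017 Rem 6.4.6.5); this line imports GLOBAL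
commutative algebra of the
permanental hypersurface instead: parafactoriality (Grothendieck1968SGA2 XI 3.14, CallLyubeznik1994)
applied to vzG's height bound
(Vonzurgathen1987 Lemma 2.3, proved in tree as `vonzurGathen1987_singPerm_height_holds`) gives
Cl(ℂ[x]/(per_n)) = 0 for n ≥ 3 — false
for n = 2 and for det_m itself (Cl(ℂ[Y]/(det)) = ℤ, BrunsVetter1988) — so a determinantal
representation of per_n must TRIVIALISE the
universal rank-one MCM module of the determinant; with vzG's affine corank-1 theorem (in tree,
`vonzurGathen1987_perm_detRepr_rank_holds`)
and the Eisenbud/Beauville2000/KernerVinnikov2012 kernel-sheaf dictionary this yields the rank-one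
trivialisation and the exact budget
identity, a reformulation of dc(per_n) in which Grenet2011 sits at (exc_c, exc_w, j) = (0, 0,
2ⁿ−2n). Nothing here is a flattening rank
or a pointwise jet; route DetQP (hypersurface differential invariants, symmetrisation) does not
touch the class group or syzygy
degrees. REPAIR 2026-08-15: the budget is a statement about a representation WITH its affine gauge —
affineness-preserving null
transvections A ↦ (1+V)·A·(1+U) move weight between j and exc_c + exc_w
(Theorems/UlrichPaddedNoTightInfinityRefutation.lean; the same
phenomenon as the GrenetRigidity negatives stmt-3735/3738 and card grenet-extended-gauge). The
engine (Cl = 0 ⇒ rank-one trivialisation ⇒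
budget identity) is untouched; the regime is fixed: tight-at-infinity (j = 0, corank-1-at-infinity)
representations exist already at
m = dc(per_3) = 7, so every floor must be joint and invariant under that gauge. The negatives index
now holds this route's own
NoTightInfinity (stmt-5668) besides 0340/3735/3738; nothing filed restates any of them. ROUTE CHOICE
2026-08-16 (c-prime-items, human-aligned): the two gauge-aware successors of NoTightInfinity are now
FILED — OrbitCorankTwo (crux r6: NoTightInfinity modulo the affine gauge GL_m(ℂ[x])×GL_m(ℂ[x]), i.e.
j* ≥ 1; the refuting witness satisfies it) and LevelledCorankTwo (support: torus-graded
representations have corank_K L ≥ 2; paper proof recorded) — so the tight regime is attacked as an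
ORBIT question (does every affine gauge orbit meet {j ≥ 1}?) and the layered regime is closed off by
a provable lemma.

RANKED CRUXES. #0 Target (target) — dc(per_n) over ℂ is not quasi-polynomially bounded (shared
target of DetQP: same normalised signature). (why it might fail: it is the Extended Valiant
Hypothesis (VNP ⊄ VQP) in dc form, strictly stronger than VP ≠ VNP; dc(per_n) = n^O(log n) is
compatible with VH; bounds are stuck at n²/2 ≤ dc ≤ 2ⁿ−1.) [BurgisserClausenShokrollahi1997,
MignonRessayre2004, Grenet2011, Landsberg2017]
#2 PermHypersurfaceFactorial (crux) — for n ≥ 3 the coordinate ring S = ℂ[x_ij]/(per_n) of the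
permanental hypersurface is factorial: every height-one prime of S is principal (card engine (ii),
Cl(P) = ℤ·h; this is the unproved named fact the whole mechanism needs, hence ranked first). Proof
plan: S is a hypersurface ring (lci), regular in codimension ≤ 3 because every prime over
singPermIdeal has height ≥ 5 (vzG Lemma 2.3, in tree) + Jacobian criterion; Grothendieck–Samuel
(SGA2 XI 3.14 / Call–Lyubeznik) ⇒ all local rings factorial ⇒ Cl(S) = Pic(S); S positively graded
normal with S₀ = ℂ ⇒ Pic(S) = 0. [difficulty: XL] (why it might fail: False at n = 2 (quadric cone,
Cl = ℤ) and for det_m (Cl = ℤ, BrunsVetter1988); at n ≥ 3 it rests on codim ≥ 4 of Sing in V(per_n)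
(vzG 2.3) + SGA2 XI 3.14 + Pic(graded normal) = 0 — a slip in the global step Cl(S) vs Cl(S_m)
leaves only local factoriality.) [Grothendieck1968SGA2, CallLyubeznik1994, Vonzurgathen1987,
BrunsVetter1988, arXiv:2402.17839]
#3 RankOneTrivialisation (crux) — for n ≥ 3 and every affine determinantal representation A of per_n
of size m over ℂ there are polynomial vectors c, w ∈ ℂ[x]^m and degrees d_c + d_w ≤ m − 1 (deg c_i ≤
d_c, deg w_i ≤ d_w) with adj A ≡ c·wᵀ (mod per_n) (card engines (i)+(ii) in matrix form: the kernel
sheaf of the padded linear matrix x₀A₀+L(x) over the graded UFD ℂ[x₀,x]/(per_n) is free of rank one,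
adj M ≡ λ·x₀^j·ĉ·ŵᵀ; dehomogenise). Consequences: deg c, deg w ≥ n−1, dc(per_n) ≥ 2n−1, and the
budget identity m = (2n−1) + exc_c + exc_w + j. [deps: PermHypersurfaceFactorial] [difficulty: L]
(why it might fail: Needs PermHypersurfaceFactorial and reflexivity (rank one) of the graded kernel
module of x₀A₀+L(x) modulo per_n; if that module is only locally free the factors c, w exist locally
on V(per_n) but not as global polynomials with deg c + deg w ≤ m − 1. False for n = 2.)
[KernerVinnikov2012, Beauville2000, Vonzurgathen1987, Grothendieck1968SGA2]
(former #4 NoTightInfinity — 'j ≥ 1 for every affine representation' — REFUTED-substantive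
2026-08-15 by
Summit.ValiantsHypothesis.Theorems.UlrichPaddedNoTightInfinity_refuted
(stmt-ValiantsHypothesis-5668; witness n = 3, m = 7: the null-transvection
twist (1+V)·Grenet·(1+U), linear part of corank 1, adj L 2 5 = X₂₀X₂₂(X₁₁X₂₀+X₁₀X₂₁)(X₁₂X₂₁+X₁₁X₂₂)
∉ (per₃)) and DROPPED from the route; it stays
in `ledger negatives` as a settled edge and is not re-filed in any wording.)
#5 Superquadratic (crux) — ∃ ε > 0 with dc(per_n) ≥ n^(2+ε) eventually (shared milestone with
DetQP.DetqpSuperquadratic; here: the first bound the budget m = 2n−1+exc_c+exc_w+j must deliver to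
show the padded engine carries more than Mignon–Ressayre). [deps: RankOneTrivialisation]
[difficulty: open-problem] (why it might fail: All engines saturate at Θ(n²) (MR04, LMR13, ABV17 Rem
1.5); here every budget coordinate is individually ZERO on a known size-7 representation of per_3 —
Grenet (0,0,2): exc_c = exc_w = 0; its null-transvection twist (1,1,0): j = 0 (the NoTightInfinity
refutation); trivial padding A ⊕ I_s only adds (0,0,s) — so only a JOINT inequality on (exc_c,
exc_w, j), invariant under affineness-preserving polynomial gauge, can work and none is identified
yet.) [MignonRessayre2004, arXiv:1004.4802, AlperBogartVelasco2017, Landsberg2017, Grenet2011]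
#6 OrbitCorankTwo (crux; C′ of the refuted NoTightInfinity, filed 2026-08-16) — for n ≥ 3 and every
affine determinantal representation A of per_n of size m there are P, Q ∈ GL_m(ℂ[x]) (unimodular
polynomial matrices) with P·A·Q affine, det = per_n, and every (m−1)-minor of the linear part of
P·A·Q in (per_n): every representation is affinely gauge-equivalent to one of padding order j ≥ 1
(corank ≥ 2 at the generic point at infinity of V(per_n)), i.e. the orbit-extremal padding order
j*(A) ≥ 1. NoTightInfinity ⇒ OrbitCorankTwo (P = Q = 1) and the refuting witness (1+V)·Grenet₇·(1+U)
satisfies it (P = 1−V, Q = 1−U give Grenet back, j = 2), so this is the honest quotient of the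
negative edge by the gauge that killed it, not a rewording. If proved: WLOG j ≥ 1 in the budget,
dc(per_n) ≥ 2n, and the maximal-j gauge is a normal form in which the j-direction of the engine is
gauge-invariant. Ranked LOW (6): informative about the regime, not load-bearing for closes. [deps:
RankOneTrivialisation] [difficulty: L] (why it might fail: j ≥ 1 is Zariski-closed and on Grenet's
component of Rep₇(per₃) only special orbit members reach it; the second, ≈126-dimensional component
(Cruxes/NoTightInfinity/EvidenceIdeator3.md, kit j012012) is generically tight and its affine
GL₇(ℂ[x])²-orbits may contain no j ≥ 1 member at all.) [Vonzurgathen1987, Ulrich1984,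
BrennanHerzogUlrich1987, BlaserEisenbudSchreyer2017, Beauville2000, KernerVinnikov2012,
Summit.ValiantsHypothesis.Theorems.UlrichPaddedNoTightInfinity_refuted]
#9 CofactorDegreeFloor (support) — budget inequality j ≤ m + 1 − 2n in cofactor form: for every
affine representation A of per_n (n ≥ 3) some cofactor of A has a homogeneous component of degree ≥
2n − 2 not divisible by per_n (corollary of RankOneTrivialisation + deg c, deg w ≥ n − 1; forbids
semisimple padding type 1^k and forces a nilpotent Jordan block of size ≥ n − 1 in the generic
pencil (L(x), Λ)). [difficulty: M] [KernerVinnikov2012, Grenet2011]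
#9 PaddedDictionary (support) — the Ulrich/padding dictionary: for n ≤ m, per_n has an affine
determinantal representation of size m iff x₀^(m−n)·per_n is the determinant of an m×m matrix of
LINEAR forms in x₀, x (homogenise entrywise / set x₀ = 1). [difficulty: provable-now]
[Beauville2000, KadishLandsberg2014, MignonRessayre2004]
#9 NoGlobalSplitting (support) — no Kerner–Vinnikov splitting of the padded matrix into an x₀-block
⊕ a per-block: per_n (n ≥ 3) is not an n×n affine determinant (one line from the in-tree
Mignon–Ressayre fact; proved in Sketch.lean). [difficulty: provable-now] [MignonRessayre2004,
KernerVinnikov2012]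
#9 LevelledCorankTwo (support; C′ filed 2026-08-16) — for n ≥ 3, if an affine determinantal
representation A = A₀ + L of per_n admits integer row/column weights α, β with α_i + β_j = 0 on the
support of A₀ and α_i + β_j = 1 on the support of L (torus-graded / levelled: layered ABP, formula
and Grenet matrices; a representation gradable after a constant gauge reduces to this by P·A·Q and
one row rescaling), then adj L = 0 identically (corank_{ℂ(x)} L ≥ 2, hence j ≥ 1). PAPER PROOF
(Cruxes/NoTightInfinity/Ideas/homothety-lift-grading.md, Lever (1)–(3); = the refuter's repair (2)
in the docstring of Theorems/UlrichPaddedNoTightInfinityRefutation.lean; signature pre-sketched as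
SketchIdeator3.adjugate_linPart_eq_zero_of_gradable): for the level grading A₀ is block-diagonal and
L has degree +1; corank A₀ = 1 (vzG Thm 3.1, `vonzurGathen1987_perm_detRepr_rank_holds`, proved)
forces equal row/column level profiles except one source and one sink level (all equal ⇒ A
block-triangular with constant square diagonal blocks ⇒ det A ∈ ℂ); corank_K L ≥ Σ_b (c_b −
r_{b−1})₊ ≥ max_b c_b − 1 (telescoping); the cokernel vector w₀ of A₀ lives on the sink level, b =
w₀ᵀL is supported on the next column level and per_n ∈ (entries of b) by the Schur complement (the
corner entry vanishes since per_n has no linear term); per_n ∉ (ℓ₁, ℓ₂) for linear forms — else Sing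
V(per_n) ⊇ V(ℓ₁, ℓ₂, g₁, g₂) has codimension ≤ 4 against vzG Lemma 2.3
(`vonzurGathen1987_singPerm_height_holds`, proved) + Krull's height theorem — so that level has ≥ 3
columns and corank_K L ≥ 2. False for n = 2 (per₂ ∈ (x₁₁, x₂₁); the 3×3 ABP representation of per₂
is levelled and tight), consistent with the guard n ≥ 3. [difficulty: M] [Vonzurgathen1987,
LandsbergRessayre2017, Grenet2011, Valiant1979]

TWO-LAYER PLAN. PermHypersurfaceFactorial ⇐ LocalFactorial (vzG height ≥ 5 + Jacobian + SGA2 XI 3.14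
at every maximal ideal) → GradedPicTrivial
(Pic of a positively graded normal ℂ-algebra) → PermHypersurfaceFactorial. RankOneTrivialisation ⇐
GradedKernelFree (kernel of
x₀A₀+L(x) mod per_n is S[x₀]·ĉ) → AffineUnimodular (vzG corank 1 ⇒ g ≡ λx₀^j) →
RankOneTrivialisation. Superquadratic ⇐ JointBudgetFloor (ONE gauge-invariant inequality on exc_c +
exc_w + j — e.g. via the orbit-extremal
padding order j* (OrbitCorankTwo is its first rung j* ≥ 1), or via kernel degrees minimised over the
affine gauge orbit) → Superquadratic. OrbitCorankTwo ⇐ TightOrbitMove (a tight representation —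
purely singular vertex pencil L_ρ ⊕ L_ωᵀ at the generic point of V(per_n), ρ + ω = m − 1 — admits an
affineness-preserving x₀-Laurent gauge lowering ρ or ω by one: the inverse of the refuter's Koszul
twist, which needs a linear syzygy feeding ker L) → OrbitCorankTwo; foreseen only, not filed (k ≤
2). The regime question the
old plan waited for is settled (2026-08-15): j = 0 IS populated at optimal size, so the floor must
control tight gauges through exc and
Grenet-type gauges through j simultaneously (k ≤ 3 each, depth 1).

KILL CRITERIA. PermHypersurfaceFactorial refuted (Cl(ℂ[x]/(per_n)) ≠ 0 for some n ≥ 3) closes the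
route outright (refuted:PermHypersurfaceFactorial):
the engine is the class group. RankOneTrivialisation refuted with factoriality intact ⇒ pivot to the
local (stalkwise) trivialisation and
re-derive the budget with a correction term. NoTightInfinity WAS refuted (2026-08-15; pre-declared
NOT fatal, and it is not: `closes` never
used it): it fixed the regime — tight-at-infinity representations exist, and since Grenet itself has
exc_c = exc_w = 0 the budget cannot be
bounded one coordinate at a time in either direction. NEW KILL: a theorem that every affine
representation of per_n (n ≥ 3, any size m) is
affinely null-transvection-equivalent to one with j = 0 AND to one with exc_c = exc_w = 0 shows each
coordinate of the split is gauge noise;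
the split then carries exactly the information of m and the route closes as exhausted (cruxes 2–3
survive as support facts for other dc
routes). OrbitCorankTwo refuted (an affine representation of some per_n, n ≥ 3, NONE of whose affine
GL_m(ℂ[x])²-gauge forms has j ≥ 1 — expected place: the tight component of Rep₇(per₃)) is
pre-declared NOT fatal (closes uses Target alone) but is half of the NEW KILL: on such orbits j ≡ 0
and the budget must be carried by exc_c + exc_w alone; OrbitCorankTwo proved makes 'maximal-j gauge'
the normal form the joint floor is to be stated in. A proof elsewhere that dc(per_n) ≤ 2^polylog(n)
refutes Target and closes this route together with
DetQP; a theorem that every triple (exc_c, exc_w, j) permitted by the budget identity is realised by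
some representation of every
size ≥ n²/2 would show the reformulation carries no more than Mignon–Ressayre — close as exhausted.

NOT DECOMPOSED YET. Kerner–Vinnikov global-from-local (KernerVinnikov2012 §3, Thm + Prop: valid for
non-reduced components, hence KNOWN) is not filed:
it only localises entanglement, and after the NoTightInfinity refutation the generic point at
infinity of V(per_n) can be a corank-1 point of
the padded matrix (twisted Grenet), where the stalk O/(x₀^k·per) is trivially indecomposable —
pointwise-generic KV data is empty. The two gauge-aware
successors of NoTightInfinity ARE NOW FILED (route choice c-prime-items, human-aligned 2026-08-16):
(α) LevelledCorankTwo as SUPPORT (true with a paper proof; it closes off the layered regime and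
bounds nothing beyond it — hence support, not crux); (β) the orbit-extremal padding order enters
through its first rung only, OrbitCorankTwo = 'j*(A) ≥ 1 for every representation' (crux r6, stated
with ∃ P Q ∈ GL_m(ℂ[x]) inline, so no definition item is needed); the quantitative 'j*(A) ≥ g(n)'
stays UNFILED — as a bound it is dc ≥ 2n−1+g(n) verbatim unless maximality supplies structure
(objection recorded in the 2026-08-16 route-choice close note and Cruxes/NoTightInfinity/NOTES.md
S3). The card's Chern/Riemann–Roch numerics (filtration 0 → Γ_H(E) → E → I_Z(a) → 0, c(E) =
(1−h)^(−m)) and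
the BGS-rank-conjecture conditional are not typed until an inequality (not an identity) is named.
The padding type (Jordan type of the
nilpotent part of the generic pencil (L(x), Λ) over ℂ(x); a block of size ≥ n−1 is forced) is
recorded under Numbers, not filed.
Definitions of Ulrich sheaf / MCM module / Cl are avoided on purpose: every item is stated in matrix
language.

CHEAPEST FALSIFIER. RAN (2026-08-15, planner folder `grenet_check_pure.py 3`, exact arithmetic):
Grenet's 7×7 representation of per_3 satisfies
the typed predictions of cruxes 3 and the supports — adj A ≡ c·wᵀ (mod per_3) with deg c = deg w = 2
= n−1, j = 2 = 2ⁿ−2n, budget 7 = 5+0+0+2,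
CofactorDegreeFloor witness at d = 4 = 2n−2. RAN by refuters (cdisprove on stmt-5668, kit j001093 /
j005012 + exact search, 2026-08-15): the
null-transvection twist (1+V)·Grenet·(1+U) is affine with det = per_3, corank L = 1 and adj L 2 5 ∉
(per₃) — NoTightInfinity REFUTED
(Theorems/UlrichPaddedNoTightInfinityRefutation.lean), budget 7 = 5+1+1+0. Next cheapest: (a) along
the two-sided null-transvection family of
Grenet at n = 3, m = 7, list the realised triples — (0,0,2) and (1,1,0) are known; a (2,0,0)/(0,2,0)
member (exc on one side only, j = 0) would
kill any left/right-symmetric floor, and the full list is the n = 3 instance of the NEW KILL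
criterion; (b) the n = 2 sanity case must FAIL
RankOneTrivialisation (it does: adj of [[x11,−x12],[x21,x22]] has linearly independent linear
entries); (c) lookup settled by the route
review: 'ℂ[x]/(per_n) is a UFD (n ≥ 3)' is KNOWN modulo Lean (vzG 2.3 proved in tree + SGA2 XI 3.14
+ Fossum1973 Cor 10.3, both vendored) —
crux 2 is Lean cost, not risk. For the C′ items (2026-08-16): (d) OrbitCorankTwo — take the
certified-or-numerical tight witnesses at (n, m) = (3, 7) (the refuter's (1+V)·Grenet₇·(1+U) passes
by untwisting; the ideator-3 witness on the ≈126-dim component,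
compute/j012012/outputs/refined2_candidate.json, is the real test) and solve the LINEAR feasibility
problem 'unipotent P = 1 + X, Q = 1 + Y of x-degree 1 with P·A·Q affine and all 6-minors of
lin(P·A·Q) vanishing on sampled points of V(per₃)' (then degree 2); infeasible at low degree on an
exactly certified tight point is strong evidence against, a hit is a proof for that orbit — one kit
job; (e) LevelledCorankTwo — a referee for the ten-line proof; numerically, Grenet_n block ranks
(corank L = 2, 5, 9 at n = 3, 4, 5, verified) and the n = 2 failure (per₂ ∈ (x₁₁, x₂₁)) bracket it.

NUMBERS. n²/2 ≤ dc(per_n) (MignonRessayre2004, in tree) ≤ 2ⁿ − 1 (Grenet2011, in tree); dc(per_3) =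
7 (AlperBogartVelasco2017); codim Sing V(per_n)
∈ [5, 2n], ≥ 6 for n ≥ 6 (Vonzurgathen1987 Lemma 2.3; BoraleviCarliniMichalekVentura2025 Thm 4.14
ff.); this line's own floor dc ≥ 2n − 1.
Budget coordinates of known families: Grenet (exc_c, exc_w, j) = (0, 0, 2ⁿ − 2n); trivial padding A
⊕ I_s adds (0, 0, s); padding type of
Grenet n = 3: corank L = 2 (rank 1+3+1 = 5 of the layered blocks; verified), n = 4: corank 5, n = 5:
corank 9 (block-rank count); twisted
Grenet (1+V)·G·(1+U), n = 3: (exc_c, exc_w, j) = (1, 1, 0), corank L = 1, budget 7 = 5+1+1+0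
(refutation of NoTightInfinity). Items at open: 9;
after the 2026-08-15 repair: 8 (target, 3 cruxes, 3 support, assembly); after the 2026-08-16 route
choice: 10 (target, 4 cruxes — PermHypersurfaceFactorial, RankOneTrivialisation proved,
Superquadratic, OrbitCorankTwo open — 4 support — 3 proved + LevelledCorankTwo — assembly proved).

DEFINITION REQUESTS. None needed at open (all items in matrix language over existing decls:
IsAffineDetRepr, HasDetRepr, Matrix.adjugate,
MvPolynomial.homogeneousComponent, Ideal.height, Submodule.IsPrincipal). Cite facts wanted (filed as
cite workitems after open):
Grothendieck–Samuel parafactoriality (Grothendieck1968SGA2 XI Cor 3.14; CallLyubeznik1994) and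
Kerner–Vinnikov global-from-local
decomposability (KernerVinnikov2012 §3 Thm 3.1 + Prop).
Not requested: the orbit-extremal padding order j* / the null-transvection gauge groupoid on
IsAffineDetRepr (card
grenet-extended-gauge posits `nullTransvection`, `extendedGaugeTangent`) — OrbitCorankTwo inlines
the gauge as ∃ P Q, IsUnit P ∧ IsUnit Q ∧ IsAffineDetRepr per_n (P·A·Q); a named j* comes only with
the joint inequality that needs it.

Novelty: Searches (2026-08-15): `lit read arxiv:0906.3012 --grep decomposab` (KV12 §3 read: non-reduced
components allowed); `lit search --source
zbmath "Ulrich complexity"` (1 relevant: doi:10.1016/j.difgeo.2017.06.001), `"permanental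
hypersurface"` (1: arXiv:2402.17839, read §4.5),
`"Fano schemes determinants permanents Chan Ilten"` (arXiv:1312.2577), `"Kerner Vinnikov
determinantal representations singular
hypersurfaces"` (1), `"Call Lyubeznik parafactoriality"` (1: zbl:0813.13017), `"permanent
hypersurface class group factorial"` (0);
`lit galaxy search "permanental hypersurface" | "Ulrich complexity" | "parafactorial" --star all` (0
rows each); local index and
OpenAlex/arXiv unavailable this session (daemon reset / HTTP 429) — logged in NOTES.md; card's own
searches (lit frontier, BES17, KV) inherited.
Nearest prior art found: BlaserEisenbudSchreyer2017 (Ulrich complexity = minimal RANK of an Ulrich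
sheaf on V(f) itself, smooth-hypersurface
bounds); KernerVinnikov2012 (kernel sheaves and decomposability of det representations of reducible
non-reduced hypersurfaces, size = degree);
Vonzurgathen1987 + BoraleviCarliniMichalekVentura2025 (codim of Sing V(per_n), no class-group
statement); Beauville2000 (det-type ⇔ rank-one ACM).
Delta: combine vzG's codim-5 theorem with Grothendieck–Samuel parafactoriality to get
Cl(ℂ[x]/(per_n)) = 0 (vs ℤ for det), and use it to
trivialise the kernel sheaf of every padded linear representation of per_n, giving the exact budget
m = 2n−1+exc_c+exc_w+j  [refs: 10.1016/j.difgeo.2017.06.001, 0906.3012, 2402.17839, 1312.2577, arxiv:0906.3012, doi:10.1016/j.difgeo.2017.06.001, BlaserEisenbudSchreyer2017, KernerVinnikov2012, Vonzurgathen1987, BoraleviCarliniMichalekVentura2025, Beauville2000]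

Barriers (technique_class: ulrich-sheaves, matrix-factorizations, parafactoriality): - technique_class: ulrich-sheaves, matrix-factorizations, parafactoriality
- Literature.Barriers.ValiantsHypothesis.ShiftedPartialsCannotSeparate: no flattening /
shifted-partials rank is used; the invariants are the class group of ℂ[x]/(per_n) and degrees of
polynomial kernel sections of a linear matrix modulo per_n (global syzygy data); conceded:
Hilbert-function data of J(x₀^k·per) would fall back inside ELSW18, so CofactorDegreeFloor-type
counts alone cannot pass n².
- Literature.Barriers.ValiantsHypothesis.PartialDerivativesDetPerm: equal partial-derivative ranks
of det and per are irrelevant here — the line separates det from per by Cl = ℤ vs Cl = 0, an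
invariant on which they provably DIFFER.
- Literature.Barriers.ValiantsHypothesis.PermanentCharTwo: respected as scope: everything is over ℂ
(n ≥ 3); in characteristic 2 per = det, Cl = ℤ and PermHypersurfaceFactorial is false, consistent
with the barrier.
- Literature.Barriers.ValiantsHypothesis.RankMethods: not a (border/tensor/Waring) rank
certification; but the honest caveat stands: 'no size-m padded factorisation' is Zariski-closed in
the coefficients of per for fixed m, so in the constructivity sense the method could be
algebraically natural (Literature.Barriers.ValiantsHypothesis.AlgebraicNaturalProofs applies exactly
as much as to every dc lower bound, DetQP included); the bet is that factoriality is a per-specific,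
non-generic property (it FAILS for det and for generic enough degenerations), i.e. not a largeness

Novelty grade: new-combination — ROUTE REVIEW (refuter c894e0d7; full text ROUTE-REVIEW.md attached; per-item notes on 5666-5672). 9 decls rc0. Crux 2 (factoriality) is KNOWN modulo Lean: vzG 2.3 PROVED in tree + SGA2 XI 3.14 + Fossum Cor 10.3 (both vendored by g14-8); gaps = Serre normality + Jacobian criterion — rank-2/XL is Lean (refuter refuter-rreview-route-CriticalPhenomena--c894e0d7-0, 2026-08-15T14:14:17Z; prior: doi:10.1016/j.difgeo.2017.06.001;arxiv:0906.3012;Beauville2000;Vonzurgathen1987;Fossum1973;AlperBogartVelasco2017)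

History (route lifecycle, newest last):
- 2026-08-15T22:51:23Z · BROKEN — NoTightInfinity (stmt-ValiantsHypothesis-5668, crux) refuted by Summit.ValiantsHypothesis.Theorems.UlrichPaddedNoTightInfinity_refuted @ ebe5c198f9c0 (refuter-cdisprove-stmt-ValiantsHypothesis-5668-0)
- 2026-08-15T23:01:43Z · rev 2: dropped NoTightInfinity — repair: NoTightInfinity (stmt-ValiantsHypothesis-5668, crux r4) refuted-SUBSTANTIVE by Summit.ValiantsHypothesis.Theorems.UlrichPaddedNoTightInfinity_refuted @e (planner-rfix-ValiantsHypothesis-UlrichPadded-e28f341f-0)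
- 2026-08-15T23:01:43Z · REPAIRED (drop NoTightInfinity) — back to open: repair: NoTightInfinity (stmt-ValiantsHypothesis-5668, crux r4) refuted-SUBSTANTIVE by Summit.ValiantsHypothesis.Theorems.UlrichPaddedNoTightInfinity_refuted @e (planner-rfix-ValiantsHypothesis-UlrichPadded-e28f341f-0)
- 2026-08-16T04:22:15Z · AUTO-CRUX (backfill): Target — hypotheses of the deciding theorem that nothing in the route derives are cruxes (operator:999:1085951)
- 2026-08-16T13:24:00Z · CLOSED refuted — refuted:stmt-ValiantsHypothesis-5668 (NoTightInfinity) by Summit.ValiantsHypothesis.Theorems.UlrichPaddedNoTightInfinity_refuted (planner-rchoice-ValiantsHypothesis-UlrichPadde-6cb3eec5-0)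
- 2026-08-16T13:37:36Z · REOPENED (operator): closure on a stale refutation choice reverted — NoTightInfinity was already dropped and never fed `closes` (operator:gate4)
- 2026-08-17T15:43:01Z · CLOSED superseded — superseded:route-ValiantsHypothesis-DetQP (planner-rbadge-ValiantsHypothesis-UlrichPadded-e28f341f-g3-0)

sub-problem: ValiantsHypothesis · status: closed(superseded) · opened planner-plancard-ValiantsHypothesis-ValiantsH-a3077279-0 2026-08-15T11:42:03Z · rev 5 · ledger route-ValiantsHypothesis-UlrichPadded
GENERATED by the gate from the ledger (D-0016/17). Provers cite these decls: `theorem foo : Summit.ValiantsHypothesis.ValiantsHypothesis.Theses.UlrichPadded.<Decl> := …` in Summits/ValiantsHypothesis/ValiantsHypothesis/Theorems/<Name>.lean.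
-/

namespace Summit.ValiantsHypothesis.ValiantsHypothesis.Theses.UlrichPadded

open scoped BigOperators Topology Manifold Classical MeasureTheory ProbabilityTheory Matrix InnerProductSpace ComplexConjugate ContinuousMap
open Filter Set Function TopologicalSpace MeasureTheory

attribute [summit_statement] _root_.ValiantsHypothesis

open Literature.PNP

/-- item stmt-ValiantsHypothesis-0315 · crux (kind.auto-crux: conjecture-grade) · rank 0 · open · by planner
why it might fail: it is the Extended Valiant Hypothesis (VNP ⊄ VQP) in dc form, strictly stronger than VP ≠ VNP; dc(per_n) = n^O(log n) is compatible with VH; bounds are stuck at n²/2 ≤ dc ≤ 2ⁿ−1.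
sources: BurgisserClausenShokrollahi1997, MignonRessayre2004, Grenet2011, Landsberg2017
Thesis of route DetQP: no c with dc(per_n) <= 2^((log2 n + c)^c) for all n (affine determinantal
complexity, Literature.Computability.AlgebraicComplexity.determinantalComplexity). Strictly stronger
than pnp.S05 (poly form). Sources: MignonRessayre2004, LandsbergRessayre2017, Grenet2011,
Burgisser2000 §2.5. -/
@[route_item "route-ValiantsHypothesis-UlrichPadded"]
def Target : Prop :=
  ¬ Literature.Computability.AlgebraicComplexity.IsQPBounded (fun n => Literature.Computability.AlgebraicComplexity.determinantalComplexity (Literature.Computability.AlgebraicComplexity.perPoly (Fin n) ℂ))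

/-- item stmt-ValiantsHypothesis-5666 · crux · rank 2 · closed · proved by Summit.ValiantsHypothesis.Theorems.permHypersurfaceFactorial_proof (prover) · by planner
why it might fail: False at n = 2 (quadric cone, Cl = ℤ) and for det_m (Cl = ℤ, BrunsVetter1988); at n ≥ 3 it rests on codim ≥ 4 of Sing in V(per_n) (vzG 2.3) + SGA2 XI 3.14 + Pic(graded normal) = 0 — a slip in the global step Cl(S) vs Cl(S_m) leaves only local factoriality.
sources: Grothendieck1968SGA2, CallLyubeznik1994, Vonzurgathen1987, BrunsVetter1988, arXiv:2402.17839
[crux] for n ≥ 3 the coordinate ring S = ℂ[x_ij]/(per_n) of the permanental hypersurface is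
factorial: every height-one prime of S is principal (card engine (ii), Cl(P) = ℤ·h; this is the
unproved named fact the whole mechanism needs, hence ranked first). Proof plan: S is a hypersurface
ring (lci), regular in codimension ≤ 3 because every prime over singPermIdeal has height ≥ 5 (vzG
Lemma 2.3, in tree) + Jacobian criterion; Grothendieck–Samuel (SGA2 XI 3.14 / Call–Lyubeznik) ⇒ all
local rings factorial ⇒ Cl(S) = Pic(S); S positively graded normal with S₀ = ℂ ⇒ Pic(S) = 0.
[difficulty: XL] -/
@[route_item "route-ValiantsHypothesis-UlrichPadded"]
def PermHypersurfaceFactorial : Prop :=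
  ∀ n : ℕ, 3 ≤ n → ∀ P : Ideal (MvPolynomial (Fin n × Fin n) ℂ ⧸ Ideal.span {Literature.Computability.AlgebraicComplexity.perPoly (Fin n) ℂ}), P.IsPrime → P.height = 1 → P.IsPrincipal

/-- item stmt-ValiantsHypothesis-5667 · crux · rank 3 · closed · proved by Summit.ValiantsHypothesis.Theorems.rankOneTrivialisation_proof @ 397cc1296b48 (prover) · by planner
why it might fail: Needs PermHypersurfaceFactorial and reflexivity (rank one) of the graded kernel module of x₀A₀+L(x) modulo per_n; if that module is only locally free the factors c, w exist locally on V(per_n) but not as global polynomials with deg c + deg w ≤ m − 1. False for n = 2.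
sources: KernerVinnikov2012, Beauville2000, Vonzurgathen1987, Grothendieck1968SGA2
[crux] for n ≥ 3 and every affine determinantal representation A of per_n of size m over ℂ there are
polynomial vectors c, w ∈ ℂ[x]^m and degrees d_c + d_w ≤ m − 1 (deg c_i ≤ d_c, deg w_i ≤ d_w) with
adj A ≡ c·wᵀ (mod per_n) (card engines (i)+(ii) in matrix form: the kernel sheaf of the padded
linear matrix x₀A₀+L(x) over the graded UFD ℂ[x₀,x]/(per_n) is free of rank one, adj M ≡
λ·x₀^j·ĉ·ŵᵀ; dehomogenise). Consequences: deg c, deg w ≥ n−1, dc(per_n) ≥ 2n−1, and the budget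
identity m = (2n−1) + exc_c + exc_w + j. [deps: PermHypersurfaceFactorial] [difficulty: L] -/
@[route_item "route-ValiantsHypothesis-UlrichPadded"]
def RankOneTrivialisation : Prop :=
  ∀ n : ℕ, 3 ≤ n → ∀ (m : ℕ) (A : Matrix (Fin m) (Fin m) (MvPolynomial (Fin n × Fin n) ℂ)), Literature.Computability.AlgebraicComplexity.IsAffineDetRepr (Literature.Computability.AlgebraicComplexity.perPoly (Fin n) ℂ) A → ∃ (c w : Fin m → MvPolynomial (Fin n × Fin n) ℂ) (dc dw : ℕ), dc + dw ≤ m - 1 ∧ (∀ i, (c i).totalDegree ≤ dc) ∧ (∀ i, (w i).totalDegree ≤ dw) ∧ ∀ i j, A.adjugate i j - c i * w j ∈ Ideal.span {Literature.Computability.AlgebraicComplexity.perPoly (Fin n) ℂ}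

/-- item stmt-ValiantsHypothesis-0318 · crux · rank 5 · open · by planner
why it might fail: All engines saturate at Θ(n²) (MR04, LMR13, ABV17 Rem 1.5); here each budget term is individually slack on a known family (Grenet: exc_c = exc_w = 0; trivial padding A ⊕ I_s: j += s), so only a JOINT inequality on (exc_c, exc_w, j) can work and none is identified yet.
sources: MignonRessayre2004, arXiv:1004.4802, AlperBogartVelasco2017, Landsberg2017, Grenet2011
Break the Hessian-rank ceiling: known dc(per_n) ≥ n^2/2 [MignonRessayre2004 Thm 1.1; CaiChenLi2010],
dc(per_3)=7 [AlperBogartVelasco2017]; upper bound 2^n-1 [Grenet2011]. Any ε>0 requires a new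
invariant of the determinant hypersurface (higher fundamental forms / singular-locus flattenings).
Most informative crux of the route. -/
@[route_item "route-ValiantsHypothesis-UlrichPadded"]
def Superquadratic : Prop :=
  ∃ ε : ℝ, 0 < ε ∧ ∃ n₀ : ℕ, ∀ n ≥ n₀, (n : ℝ) ^ (2 + ε) ≤ (Literature.Computability.AlgebraicComplexity.determinantalComplexity (Literature.Computability.AlgebraicComplexity.perPoly (Fin n) ℂ) : ℝ)

/-- item stmt-ValiantsHypothesis-15032 · crux · rank 6 · closed · moot by None · by planner
why it might fail: j ≥ 1 is Zariski-closed; on Grenet's component of Rep₇(per₃) only special orbit members reach it, and the second, ≈126-dim, generically tight component (EvidenceIdeator3, kit j012012) may have affine GL₇(ℂ[x])²-orbits with no j ≥ 1 member at all.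
sources: Vonzurgathen1987, Ulrich1984, BrennanHerzogUlrich1987, BlaserEisenbudSchreyer2017, Beauville2000, KernerVinnikov2012
[crux] NoTightInfinity modulo the affine gauge GL_m(ℂ[x]) × GL_m(ℂ[x]) (C′ of the refuted
stmt-ValiantsHypothesis-5668; route choice c-prime-items, human-aligned 2026-08-16): for n ≥ 3 and
every affine determinantal representation A of per_n of size m there are unimodular polynomial
matrices P, Q (IsUnit in Matrix (Fin m) (Fin m) ℂ[x]) with P·A·Q again affine, det (P·A·Q) = per_n,
and every (m−1)-minor of the linear part of P·A·Q in (per_n) — every representation is affinely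
gauge-equivalent to one of padding order j ≥ 1 (corank ≥ 2 at the generic point at infinity of
V(per_n)); equivalently the orbit-extremal padding order j*(A) ≥ 1. Not a rewording of the negative
edge: NoTightInfinity ⇒ OrbitCorankTwo with P = Q = 1 (planner Sketch.lean, rc 0) and the refuting
witness (1+V)·Grenet₇·(1+U) SATISFIES it (P = 1−V, Q = 1−U return Grenet, j = 2). If proved: WLOG j
≥ 1 in the budget m = 2n−1+exc_c+exc_w+j, dc(per_n) ≥ 2n, and the maximal-j gauge is a normal form
in which the j-direction of the engine is gauge-invariant; if refuted (expected place: the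
generically tight ≈126-dim component of Rep₇(per₃), Cruxes/NoTightInfinity/EvidenceIdeator3.md): on
such orbits j ≡ 0 and the budget mus -/
@[route_item "route-ValiantsHypothesis-UlrichPadded"]
def OrbitCorankTwo : Prop :=
  ∀ n : ℕ, 3 ≤ n → ∀ (m : ℕ) (A : Matrix (Fin m) (Fin m) (MvPolynomial (Fin n × Fin n) ℂ)), Literature.Computability.AlgebraicComplexity.IsAffineDetRepr (Literature.Computability.AlgebraicComplexity.perPoly (Fin n) ℂ) A → ∃ P Q : Matrix (Fin m) (Fin m) (MvPolynomial (Fin n × Fin n) ℂ), IsUnit P ∧ IsUnit Q ∧ Literature.Computability.AlgebraicComplexity.IsAffineDetRepr (Literature.Computability.AlgebraicComplexity.perPoly (Fin n) ℂ) (P * A * Q) ∧ ∀ i j, (Matrix.of fun a b => MvPolynomial.homogeneousComponent 1 ((P * A * Q) a b)).adjugate i j ∈ Ideal.span {Literature.Computability.AlgebraicComplexity.perPoly (Fin n) ℂ}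

/-- item stmt-ValiantsHypothesis-15033 · support · rank 9 · closed · proved by Summit.ValiantsHypothesis.Theorems.levelledCorankTwo_proof @ 690df06378e8 (prover) · by planner
sources: Vonzurgathen1987, LandsbergRessayre2017, Grenet2011, Valiant1979, Summits/ValiantsHypothesis/ValiantsHypothesis/Cruxes/NoTightInfinity/Ideas/homothety-lift-grading.md
[support] levelled (torus-graded) representations are deep in the non-tight regime (C′ support;
route choice c-prime-items, human-aligned 2026-08-16): for n ≥ 3, if an affine determinantal
representation A = A₀ + L of per_n admits integer row/column weights α, β with α_i + β_j = 0 on the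
support of A₀ and α_i + β_j = 1 on the support of L (layered ABP / formula / Grenet matrices; a
representation gradable after a constant gauge reduces to this by P·A·Q and one row rescaling), then
adj L = 0 identically (corank over ℂ(x) of L ≥ 2; in particular j ≥ 1, NoTightInfinity's conclusion,
for this class). PAPER PROOF
(Summits/ValiantsHypothesis/ValiantsHypothesis/Cruxes/NoTightInfinity/Ideas/homothety-lift-grading.md,
Lever (1)–(3); the same argument is the refuter's repair (2) in the docstring of
Theorems/UlrichPaddedNoTightInfinityRefutation.lean; pre-sketched signature
Cruxes/NoTightInfinity/SketchIdeator3.lean `adjugate_linPart_eq_zero_of_gradable`): for the level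
grading A₀ is block-diagonal and L has degree +1; corank A₀ = 1 (vzG Thm 3.1,
`vonzurGathen1987_perm_detRepr_rank_holds`, PROVED in tree) forces equal row/column level profiles
except one source and one sink level (all equal ⇒ -/
@[route_item "route-ValiantsHypothesis-UlrichPadded"]
def LevelledCorankTwo : Prop :=
  ∀ n : ℕ, 3 ≤ n → ∀ (m : ℕ) (A : Matrix (Fin m) (Fin m) (MvPolynomial (Fin n × Fin n) ℂ)), Literature.Computability.AlgebraicComplexity.IsAffineDetRepr (Literature.Computability.AlgebraicComplexity.perPoly (Fin n) ℂ) A → ∀ α β : Fin m → ℤ, (∀ i j, MvPolynomial.constantCoeff (A i j) ≠ 0 → α i + β j = 0) → (∀ i j, MvPolynomial.homogeneousComponent 1 (A i j) ≠ 0 → α i + β j = 1) → (Matrix.of fun a b => MvPolynomial.homogeneousComponent 1 (A a b)).adjugate = 0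

/-- item stmt-ValiantsHypothesis-5669 · support · rank 9 · closed · proved by Summit.ValiantsHypothesis.Theorems.cofactorDegreeFloor_proof (prover) · by planner
sources: KernerVinnikov2012, Grenet2011
[support] budget inequality j ≤ m + 1 − 2n in cofactor form: for every affine representation A of
per_n (n ≥ 3) some cofactor of A has a homogeneous component of degree ≥ 2n − 2 not divisible by
per_n (corollary of RankOneTrivialisation + deg c, deg w ≥ n − 1; forbids semisimple padding type
1^k and forces a nilpotent Jordan block of size ≥ n − 1 in the generic pencil (L(x), Λ)).
[difficulty: M] -/
@[route_item "route-ValiantsHypothesis-UlrichPadded"]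
def CofactorDegreeFloor : Prop :=
  ∀ n : ℕ, 3 ≤ n → ∀ (m : ℕ) (A : Matrix (Fin m) (Fin m) (MvPolynomial (Fin n × Fin n) ℂ)), Literature.Computability.AlgebraicComplexity.IsAffineDetRepr (Literature.Computability.AlgebraicComplexity.perPoly (Fin n) ℂ) A → ∃ (i j : Fin m) (d : ℕ), 2 * n - 2 ≤ d ∧ MvPolynomial.homogeneousComponent d (A.adjugate i j) ∉ Ideal.span {Literature.Computability.AlgebraicComplexity.perPoly (Fin n) ℂ}

/-- item stmt-ValiantsHypothesis-5670 · support · rank 9 · closed · proved by Summit.ValiantsHypothesis.Theorems.paddedDictionary_proof (prover) · by planner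
sources: Beauville2000, KadishLandsberg2014, MignonRessayre2004
[support] the Ulrich/padding dictionary: for n ≤ m, per_n has an affine determinantal representation
of size m iff x₀^(m−n)·per_n is the determinant of an m×m matrix of LINEAR forms in x₀, x
(homogenise entrywise / set x₀ = 1). [difficulty: provable-now] -/
@[route_item "route-ValiantsHypothesis-UlrichPadded"]
def PaddedDictionary : Prop :=
  ∀ n m : ℕ, n ≤ m → (Literature.Computability.AlgebraicComplexity.HasDetRepr (Literature.Computability.AlgebraicComplexity.perPoly (Fin n) ℂ) m ↔ ∃ M : Matrix (Fin m) (Fin m) (MvPolynomial (Option (Fin n × Fin n)) ℂ), (∀ i j, (M i j).IsHomogeneous 1) ∧ M.det = MvPolynomial.X none ^ (m - n) * MvPolynomial.rename some (Literature.Computability.AlgebraicComplexity.perPoly (Fin n) ℂ))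

/-- item stmt-ValiantsHypothesis-5671 · support · rank 9 · closed · proved by Summit.ValiantsHypothesis.Theorems.noGlobalSplitting_proof @ 35f8efd1ceb4 (prover) · by planner
sources: MignonRessayre2004, KernerVinnikov2012
[support] no Kerner–Vinnikov splitting of the padded matrix into an x₀-block ⊕ a per-block: per_n (n
≥ 3) is not an n×n affine determinant (one line from the in-tree Mignon–Ressayre fact; proved in
Sketch.lean). [difficulty: provable-now] -/
@[route_item "route-ValiantsHypothesis-UlrichPadded"]
def NoGlobalSplitting : Prop :=
  ∀ n : ℕ, 3 ≤ n → ¬ Literature.Computability.AlgebraicComplexity.HasDetRepr (Literature.Computability.AlgebraicComplexity.perPoly (Fin n) ℂ) n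

/-- item stmt-ValiantsHypothesis-5672 · assembly · rank 1 · closed · proved by Summit.ValiantsHypothesis.Theorems.ulrichPadded_assembly_proof @ 27d4eb856da2 (prover) · by planner
sources: BurgisserClausenShokrollahi1997, Valiant1979, Burgisser2000
[assembly] (VP ⇒ qp-bounded dc) → Target → (renaming bridge for the permanent family) → per ∈ VNP →
ValiantsHypothesis. -/
@[route_item "route-ValiantsHypothesis-UlrichPadded"]
def Assembly : Prop :=
  (∀ {σ : ℕ → Type} [∀ n, Fintype (σ n)] (f : ∀ n, MvPolynomial (σ n) ℂ), Literature.Computability.AlgebraicComplexity.IsVPFamily f → Literature.Computability.AlgebraicComplexity.IsQPBounded (fun n => Literature.Computability.AlgebraicComplexity.determinantalComplexity (f n))) → Target → (Literature.Computability.AlgebraicComplexity.perFamily ℂ ∈ Literature.Computability.AlgebraicComplexity.VP ℂ ↔ Literature.Computability.AlgebraicComplexity.IsVPFamily (fun n => Literature.Computability.AlgebraicComplexity.perPoly (Fin n) ℂ)) → Literature.Computability.AlgebraicComplexity.perFamily_mem_VNP ℂ → ValiantsHypothesis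

-- records of items no longer active in this route (dropped / restated):
-- earlier NoTightInfinity (stmt-ValiantsHypothesis-5668, dropped 2026-08-15T23:01:43Z): refuted by Summit.ValiantsHypothesis.Theorems.UlrichPaddedNoTightInfinity_refuted @ ebe5c198f9c0 — ∀ n : ℕ, 3 ≤ n → ∀ (m : ℕ) (A : Matrix (Fin m) (Fin m) (MvPolynomial (Fin n × Fin n) ℂ)), Literature.Computability.AlgebraicComplexity.IsAffineDetRepr (Literature.Computability.AlgebraicComplexity.perPoly (Fin n) ℂ)

end Summit.ValiantsHypothesis.ValiantsHypothesis.Theses.UlrichPadded
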